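import Summits.QuantumFields.BalabanUV.T4Continuum.Support.TorusSlicing
import Summits.QuantumFields.BalabanUV.T4Continuum.Support.DirichletMonotoneCutoff
import Summits.QuantumFields.BalabanUV.Beta.GAN24.DirichletBoxTrace

/-!
# `BalabanUV.T4Continuum.Support.DirichletTubeBlock` — NE2 (node U1a) formalisation swarm, sub-row `T4-U1a.S-NE2-D1-DIRICHLET°`, supplier item
# «Δ1-TUBES» (file T1): THE JUNCTION BETWEEN SLICING AND BLOCKS — a site of the fine torus `Tor (fine n M)`, `M : Fin (d+1) → ℕ`, read through
# gen 6's slicing `ins t y` along a longitudinal axis `λ`, has block `insertNth λ (blk1 t) (blockOf y)` and offset `insertNth λ (off1 t) (offsF y)`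
# with respect to the TRANSVERSAL block moduli `Msl M λ = M ∘ λ.succAbove` (and `Nsl (fine n M) λ = fine n (Msl M λ)` definitionally); hence the
# slice of a field supported in a block region `blockReg S` is supported in the transversal block region of the SLICE SET `Ssl S (blk1 t)`
# (unit b2b-balaban-t4-ne2-formalise-leaf-08, gen 7, file T1)

HONEST FRAMING.  Lattice bookkeeping at MODEL level (finite torus); [folklore]; NE2 (U1a) is NOT proved by this file; spine PROVED 0/9 unchanged;
NOT infinite volume, NOT the mass gap, NOT Clay.  HONEST DEPENDENCY (verbatim): «continuum YM on T⁴ ⇐ BetaPertH ∧ nine spine estimates (0/9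
proved); BetaPertH ⇐ (D1) ∧ (D4) ∧ CAP+tail; G-an2-4 gates asym, D1 and NE2/3/4.»

WHAT THIS FILE PROVES (0 sorry).  Data `Msl`, `blk1`, `off1`, `Ssl`; `Nsl_fine`, `blk1_val`, `ins_eq_bpt`, **`blockOf_ins`**, `offsF_ins`,
`blockOf_ins_self`, `blockOf_ins_succAbove`, `offsF_ins_self`, `offsF_ins_succAbove`, `ins_removeNth`, **`blockReg_ins_iff`**, **`zsl_support`**.

ABSOLUTE RULE (cell, verbatim): «No internally-minted statement may enter as a cited fact. Every hypothesis is either kernel-proved in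
this package or a verbatim quotation of a PUBLISHED theorem with page reference. The manuscript(s) under audit are NOT citable for
their own disputed steps — they are the thing under adjudication; programme-internal (2001/route/tribunal) claims are never citable.»
[folklore]; data definitions; no `def … : Prop` fact (`Ssl` is a set-valued datum with parameters).  NOT CLAIMED: any estimate, NE2, NE3.
-/

noncomputable section

open scoped BigOperators

namespace Summit.QuantumFields.BalabanUV.T4Continuum.DirichletTubeBlock

open Literature.MathematicalPhysics.QuantumFieldTheory.Balaban1983to89.B5Prop11Plancherel (Tor fine)
open Literature.MathematicalPhysics.QuantumFieldTheory.Balaban1983to89.B5Block118 (bpt)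
open Literature.MathematicalPhysics.QuantumFieldTheory.Balaban1983to89.B5Blocks16 (blockOf blockOf_bpt bpt_eq_natCast)
open Summit.QuantumFields.BalabanUV.Beta.GAN24.DirichletBoxTrace (blockReg)
open Summit.QuantumFields.BalabanUV.T4Continuum.DirichletMonotoneCutoff (offsF offsF_bpt bpt_blockOf_offsF)
open Summit.QuantumFields.BalabanUV.T4Continuum.TorusSlicing (Nsl ins zsl ins_apply_self ins_apply_succAbove)

variable {d : ℕ} (n : ℕ) [NeZero n] (M : Fin (d + 1) → ℕ) [hM : ∀ μ, NeZero (M μ)] (lam : Fin (d + 1))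

/-- the TRANSVERSAL block moduli `M ∘ λ.succAbove`. [folklore] -/
abbrev Msl : Fin d → ℕ := fun j => M (lam.succAbove j)

/-- the transversal block moduli are non-zero. [folklore] -/
instance instNeZeroMsl (j : Fin d) : NeZero (Msl M lam j) := hM (lam.succAbove j)

omit hM [NeZero n] in
/-- the transversal fine torus of gen 6's slicing IS the fine torus of the transversal block moduli (definitional). [folklore] -/
theorem Nsl_fine : Nsl (fine n M) lam = fine n (Msl M lam) := rfl

/-- the 1-D block of a longitudinal coordinate. [folklore] -/
def blk1 (t : ZMod (fine n M lam)) : ZMod (M lam) := ((t.val / n : ℕ) : ZMod (M lam))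

/-- the 1-D offset of a longitudinal coordinate. [folklore] -/
def off1 (t : ZMod (fine n M lam)) : Fin n := ⟨t.val % n, Nat.mod_lt _ (Nat.pos_of_ne_zero (NeZero.ne n))⟩

/-- the SLICE SET of a block set at the 1-D block `b`: the transversal blocks `β′` with `insertNth λ b β′ ∈ S`. [folklore] -/
def Ssl (S : Tor M → Prop) (b : ZMod (M lam)) : Tor (Msl M lam) → Prop := fun β' => S (Fin.insertNth lam b β')

/-- the slice set is decidable. [folklore] -/
instance decSsl (S : Tor M → Prop) [DecidablePred S] (b : ZMod (M lam)) : DecidablePred (Ssl M lam S b) :=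
  fun β' => inferInstanceAs (Decidable (S (Fin.insertNth lam b β')))

/-- `(blk1 t).val = t.val / n`. [folklore] -/
theorem blk1_val (t : ZMod (fine n M lam)) : (blk1 n M lam t).val = t.val / n := by
  unfold blk1
  rw [ZMod.val_natCast_of_lt]
  have ht : t.val < n * M lam := ZMod.val_lt t
  exact Nat.div_lt_of_lt_mul ht

/-- **the sliced site in block coordinates**: `ins t y = bpt (insertNth λ (blk1 t) (blockOf y)) (insertNth λ (off1 t) (offsF y))`. [folklore] -/
theorem ins_eq_bpt (t : ZMod (fine n M lam)) (y : Tor (fine n (Msl M lam))) :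
    ins (fine n M) lam t y = bpt n M (Fin.insertNth lam (blk1 n M lam t) (blockOf n (Msl M lam) y))
      (Fin.insertNth (α := fun _ => Fin n) lam (off1 n M lam t) (offsF n (Msl M lam) y)) := by
  funext ν
  rcases Fin.eq_self_or_eq_succAbove lam ν with h | ⟨i, hi⟩
  · subst h
    rw [ins_apply_self, bpt_eq_natCast, Fin.insertNth_apply_same, Fin.insertNth_apply_same, blk1_val]
    have : n * (t.val / n) + ((off1 n M ν t : Fin n) : ℕ) = t.val := Nat.div_add_mod t.val n
    rw [this, ZMod.natCast_zmod_val]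
  · subst hi
    rw [ins_apply_succAbove, bpt_eq_natCast, Fin.insertNth_apply_succAbove, Fin.insertNth_apply_succAbove]
    have h := bpt_eq_natCast n (Msl M lam) (blockOf n (Msl M lam) y) (offsF n (Msl M lam) y) i
    rw [bpt_blockOf_offsF] at h
    exact h

/-- **the block of a sliced site**: `blockOf (ins t y) = insertNth λ (blk1 t) (blockOf y)`. [folklore] -/
theorem blockOf_ins (t : ZMod (fine n M lam)) (y : Tor (fine n (Msl M lam))) :
    blockOf n M (ins (fine n M) lam t y) = Fin.insertNth lam (blk1 n M lam t) (blockOf n (Msl M lam) y) := by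
  rw [ins_eq_bpt, blockOf_bpt]

/-- the offset of a sliced site: `offsF (ins t y) = insertNth λ (off1 t) (offsF y)`. [folklore] -/
theorem offsF_ins (t : ZMod (fine n M lam)) (y : Tor (fine n (Msl M lam))) :
    offsF n M (ins (fine n M) lam t y) = Fin.insertNth (α := fun _ => Fin n) lam (off1 n M lam t) (offsF n (Msl M lam) y) := by
  rw [ins_eq_bpt, offsF_bpt]

/-- the longitudinal block coordinate of a sliced site. [folklore] -/
theorem blockOf_ins_self (t : ZMod (fine n M lam)) (y : Tor (fine n (Msl M lam))) :
    blockOf n M (ins (fine n M) lam t y) lam = blk1 n M lam t := by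
  rw [blockOf_ins, Fin.insertNth_apply_same]

/-- the transversal block coordinates of a sliced site. [folklore] -/
theorem blockOf_ins_succAbove (t : ZMod (fine n M lam)) (y : Tor (fine n (Msl M lam))) (i : Fin d) :
    blockOf n M (ins (fine n M) lam t y) (lam.succAbove i) = blockOf n (Msl M lam) y i := by
  rw [blockOf_ins, Fin.insertNth_apply_succAbove]

/-- the longitudinal offset of a sliced site. [folklore] -/
theorem offsF_ins_self (t : ZMod (fine n M lam)) (y : Tor (fine n (Msl M lam))) :
    offsF n M (ins (fine n M) lam t y) lam = off1 n M lam t := by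
  rw [offsF_ins, Fin.insertNth_apply_same]

/-- the transversal offsets of a sliced site. [folklore] -/
theorem offsF_ins_succAbove (t : ZMod (fine n M lam)) (y : Tor (fine n (Msl M lam))) (i : Fin d) :
    offsF n M (ins (fine n M) lam t y) (lam.succAbove i) = offsF n (Msl M lam) y i := by
  rw [offsF_ins, Fin.insertNth_apply_succAbove]

omit hM [NeZero n] in
/-- every site is a sliced site: `x = ins (x λ) (removeNth λ x)`. [folklore] -/
theorem ins_removeNth (x : Tor (fine n M)) : ins (fine n M) lam (x lam) (Fin.removeNth lam x) = x :=
  Fin.insertNth_self_removeNth lam x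

/-- **block regions slice into block regions**: `ins t y ∈ blockReg S ↔ y ∈ blockReg (Ssl S (blk1 t))`. [folklore] -/
theorem blockReg_ins_iff (S : Tor M → Prop) (t : ZMod (fine n M lam)) (y : Tor (fine n (Msl M lam))) :
    blockReg n M S (ins (fine n M) lam t y) ↔ blockReg n (Msl M lam) (Ssl M lam S (blk1 n M lam t)) y := by
  simp only [blockReg, blockOf_ins, Ssl]

/-- **the slice of a field supported in a block region is supported in the sliced block region.** [folklore] -/
theorem zsl_support (S : Tor M → Prop) {z : Tor (fine n M) → ℂ} (hz : ∀ x, ¬ blockReg n M S x → z x = 0) (t : ZMod (fine n M lam)) :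
    ∀ y, ¬ blockReg n (Msl M lam) (Ssl M lam S (blk1 n M lam t)) y → zsl (fine n M) lam z t y = 0 :=
  fun y hy => hz _ fun h => hy ((blockReg_ins_iff n M lam S t y).mp h)

end Summit.QuantumFields.BalabanUV.T4Continuum.DirichletTubeBlock

end
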